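import Summits.Parity.GeneralizedHardyLittlewood.Theorems.ChenParityOracleBLAPHostParityFromBrickSwitchedCount
import Summits.Parity.GeneralizedHardyLittlewood.Theorems.ChenParityOracleBLAPHostParityFromBrickSifting
import Summits.Parity.GeneralizedHardyLittlewood.Theorems.ChenParityOracleBLAPHostParityFromBrickSiftedTail
import Literature.NumberTheory.LFunctions.LiouvilleSumClassicalBound
import Mathlib.NumberTheory.Chebyshev
import HarnessLib

/-!
# Route `ChenParityOracleBLAP` — crux S1 = `HostParityFromBrick` (stmt-Parity-20045): the small pieces of the prime host

Support file for the prime half `K1 → K2 → HP1` of S1 (steps (V), (F2)).  Trivial bounds for the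
pieces of `∑_{k ≤ y} Λ(k) f_d(k)`, `f_d(k) = [d ∣ k+2] λ(k+2)`, that are not Type I/II:
* `sum_abs_level_trivial_le` — `∑_{d ≤ D} |∑_{k ≤ y} Λ(k) f_d(k)| ≤ (log y)(y+2)(1 + log(y+2))`
  (small heights);
* `sum_abs_T0_le` — the piece `Λ_{≤U}`: `≤ #Dset · 6U`;
* `sum_abs_nonrough_le` — prime powers `p^a ≤ y` with `p < N` (non-rough support of `Λ`):
  `≤ #Dset · N (log₂ y + 1) log y`;
* `sum_abs_even_moduli_le` — even `d` see only `k = 2^a`: `≤ D (log₂ y + 1)`.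

References: H. Iwaniec, E. Kowalski, *Analytic Number Theory* (2004), §13.4 [IwaniecKowalski2004].
-/

namespace Summit.Parity.GeneralizedHardyLittlewood.Theorems

open Finset Real
open ArithmeticFunction

/-- `|∑_{k ≤ y} Λ(k) f_d(k)| ≤ ∑_{k ≤ y, d ∣ k+2} Λ(k)`-type bookkeeping: for `|f| ≤ 1`,
`∑_{d ∈ Dset} |∑_{k ∈ S} Λ(k) g(k) [d ∣ k+2] λ(k+2)| ≤ ∑_{k ∈ S} Λ(k) |g k| #{d ∈ Dset : d ∣ k+2}`. -/
theorem sum_abs_le_sum_vonMangoldt_card (Dset S : Finset ℕ) (g : ℕ → ℝ) :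
    ∑ d ∈ Dset, |∑ k ∈ S, vonMangoldt k * (g k *
        (if d ∣ k + 2 then (liouville (k + 2) : ℝ) else 0))| ≤
      ∑ k ∈ S, vonMangoldt k * |g k| * #(Dset.filter (fun d => d ∣ k + 2)) := by
  classical
  calc ∑ d ∈ Dset, |∑ k ∈ S, vonMangoldt k * (g k *
          (if d ∣ k + 2 then (liouville (k + 2) : ℝ) else 0))|
      ≤ ∑ d ∈ Dset, ∑ k ∈ S, vonMangoldt k * |g k| * (if d ∣ k + 2 then (1 : ℝ) else 0) := by
        refine Finset.sum_le_sum fun d _ => (Finset.abs_sum_le_sum_abs _ _).trans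
          (Finset.sum_le_sum fun k _ => ?_)
        rw [abs_mul, abs_mul, abs_of_nonneg vonMangoldt_nonneg]
        split_ifs with h
        · have := Literature.NumberTheory.LFunctions.LiouvilleSum.abs_liouville_le_one (k + 2)
          have h0 : 0 ≤ vonMangoldt k * |g k| := mul_nonneg vonMangoldt_nonneg (abs_nonneg _)
          nlinarith
        · simp
    _ = ∑ k ∈ S, vonMangoldt k * |g k| * #(Dset.filter (fun d => d ∣ k + 2)) := by
        rw [Finset.sum_comm]
        refine Finset.sum_congr rfl fun k _ => ?_
        rw [← Finset.mul_sum, ← Finset.sum_filter, Finset.sum_const, nsmul_eq_mul, mul_one]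

/-- **Trivial bound (small heights).**  `∑_{d ≤ D} |∑_{k ≤ y} Λ(k) f_d(k)| ≤ log y · (y+2)(1+log(y+2))`. -/
theorem sum_abs_level_trivial_le (D y : ℕ) :
    ∑ d ∈ Icc 1 D, |∑ k ∈ Icc 1 y, vonMangoldt k *
        (if d ∣ k + 2 then (liouville (k + 2) : ℝ) else 0)| ≤
      Real.log y * (((y + 2 : ℕ) : ℝ) * (1 + Real.log ((y + 2 : ℕ) : ℝ))) := by
  classical
  have h := sum_abs_le_sum_vonMangoldt_card (Icc 1 D) (Icc 1 y) (fun _ => (1 : ℝ))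
  simp only [one_mul, abs_one, mul_one] at h
  refine h.trans ?_
  -- `Λ(k) ≤ log y`, `#{d : d ∣ k+2} ≤ τ(k+2)`, `∑ τ(k+2) ≤ (y+2)(1+log(y+2))`
  have h1 : ∀ k ∈ Icc 1 y, vonMangoldt k * (#((Icc 1 D).filter (fun d => d ∣ k + 2)) : ℝ) ≤
      Real.log y * ((k + 2).divisors.card : ℝ) := by
    intro k hk
    rw [Finset.mem_Icc] at hk
    refine mul_le_mul (vonMangoldt_le_log.trans (Real.log_le_log (by exact_mod_cast hk.1)
      (by exact_mod_cast hk.2))) ?_ (Nat.cast_nonneg _) (Real.log_natCast_nonneg y)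
    have := card_filter_dvd_le_sigma_zero (Icc 1 D) (by omega : k + 2 ≠ 0)
    rw [ArithmeticFunction.sigma_zero_apply] at this
    exact_mod_cast this
  refine (Finset.sum_le_sum h1).trans ?_
  rw [← Finset.mul_sum]
  refine mul_le_mul_of_nonneg_left ?_ (Real.log_natCast_nonneg y)
  have hinj : Set.InjOn (fun k : ℕ => k + 2) (Icc 1 y : Set ℕ) := fun a _ b _ h => by simpa using h
  rw [← Finset.sum_image (f := fun n => (n.divisors.card : ℝ)) hinj]
  refine sum_card_divisors_le_of_subset_Icc fun n hn => ?_
  rw [Finset.mem_image] at hn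
  obtain ⟨k, hk, rfl⟩ := hn
  rw [Finset.mem_Icc] at hk ⊢; omega

/-- **The piece `Λ_{≤U}`.**  `∑_{d ∈ Dset} |∑_{k ≤ U} Λ(k) h_d(k)| ≤ #Dset · 6U` for any `|h_d| ≤ 1`
weight of the form `g(k)[d ∣ k+2]λ(k+2)` with `|g| ≤ 1`. -/
theorem sum_abs_T0_le (Dset : Finset ℕ) (U : ℕ) (g : ℕ → ℝ) (hg : ∀ k, |g k| ≤ 1) :
    ∑ d ∈ Dset, |∑ k ∈ Ioc 0 U, vonMangoldt k * (g k *
        (if d ∣ k + 2 then (liouville (k + 2) : ℝ) else 0))| ≤ #Dset * (6 * U) := by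
  classical
  have hψ : ∑ k ∈ Ioc 0 U, vonMangoldt k ≤ 6 * U := by
    have h := Chebyshev.psi_le_const_mul_self (x := (U : ℝ)) (Nat.cast_nonneg U)
    rw [Chebyshev.psi, Nat.floor_natCast] at h
    refine h.trans (mul_le_mul_of_nonneg_right ?_ (Nat.cast_nonneg U))
    have : Real.log 4 < 2 := by
      have h4 : Real.log 4 = 2 * Real.log 2 := by
        rw [show (4 : ℝ) = 2 ^ 2 by norm_num, Real.log_pow]; push_cast; ring
      rw [h4]; linarith [Real.log_two_lt_d9]
    linarith
  calc ∑ d ∈ Dset, |∑ k ∈ Ioc 0 U, vonMangoldt k * (g k *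
          (if d ∣ k + 2 then (liouville (k + 2) : ℝ) else 0))|
      ≤ ∑ d ∈ Dset, ∑ k ∈ Ioc 0 U, vonMangoldt k := by
        refine Finset.sum_le_sum fun d _ => (Finset.abs_sum_le_sum_abs _ _).trans
          (Finset.sum_le_sum fun k _ => ?_)
        rw [abs_mul, abs_of_nonneg vonMangoldt_nonneg]
        have h1 : |g k * (if d ∣ k + 2 then (liouville (k + 2) : ℝ) else 0)| ≤ 1 := by
          rw [abs_mul]
          have := hg k
          split_ifs
          · have := Literature.NumberTheory.LFunctions.LiouvilleSum.abs_liouville_le_one (k + 2)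
            exact (mul_le_mul (hg k) this (abs_nonneg _) zero_le_one).trans (by norm_num)
          · simp
        exact (mul_le_mul_of_nonneg_left h1 vonMangoldt_nonneg).trans (by rw [mul_one])
    _ ≤ ∑ d ∈ Dset, (6 * (U : ℝ)) := Finset.sum_le_sum fun _ _ => hψ
    _ = #Dset * (6 * U) := by rw [Finset.sum_const, nsmul_eq_mul]

/-- Prime powers: if `Λ(k) ≠ 0` and `k` is not coprime to `(N−1)#`, then `k = p^a` with `p < N`,
`1 ≤ a ≤ log₂ k`. -/
theorem exists_pow_eq_of_not_coprime_primorial {N k : ℕ} (hk : vonMangoldt k ≠ 0)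
    (hcop : ¬ Nat.Coprime k (primorial (N - 1))) :
    ∃ p a : ℕ, p < N ∧ 1 ≤ a ∧ a ≤ Nat.log 2 k ∧ p ^ a = k := by
  have hpp : IsPrimePow k := vonMangoldt_ne_zero_iff.mp hk
  obtain ⟨p, a, hp, ha, rfl⟩ := (isPrimePow_nat_iff _).mp hpp
  refine ⟨p, a, ?_, ha, ?_, rfl⟩
  · -- a prime `q ∣ gcd(p^a, P)` must be `p`, and `q ∣ P` gives `q ≤ N - 1`
    rw [Nat.coprime_iff_gcd_eq_one] at hcop
    obtain ⟨q, hq, hqg⟩ := Nat.exists_prime_and_dvd hcop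
    have hqk : q ∣ p ^ a := hqg.trans (Nat.gcd_dvd_left _ _)
    have hqP : q ∣ primorial (N - 1) := hqg.trans (Nat.gcd_dvd_right _ _)
    have hqp : q = p := (Nat.prime_dvd_prime_iff_eq hq hp).mp (hq.dvd_of_dvd_pow hqk)
    have := hq.dvd_primorial_iff.mp hqP
    have := hp.two_le
    omega
  · exact Nat.le_log_of_pow_le (by norm_num) (Nat.pow_le_pow_left hp.two_le a)

/-- **Non-rough prime powers.**  `∑_{d ∈ Dset} |∑_{k ≤ y} Λ(k)(1 − 1_{(k,P)=1}) f_d(k)| ≤ #Dset · N (log₂ y + 1) log y`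
(`P = (N−1)#`). -/
theorem sum_abs_nonrough_le (Dset : Finset ℕ) (N y : ℕ) :
    ∑ d ∈ Dset, |∑ k ∈ Ioc 0 y, vonMangoldt k *
        ((1 - (if Nat.Coprime k (primorial (N - 1)) then (1 : ℝ) else 0)) *
          (if d ∣ k + 2 then (liouville (k + 2) : ℝ) else 0))| ≤
      #Dset * ((N : ℝ) * (Nat.log 2 y + 1 : ℕ) * Real.log y) := by
  classical
  set P := primorial (N - 1) with hP
  -- the support
  set S := (Ioc 0 y).filter (fun k => ¬ Nat.Coprime k P ∧ vonMangoldt k ≠ 0) with hS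
  have hcardS : #S ≤ N * (Nat.log 2 y + 1) := by
    have hsub : S ⊆ ((range N) ×ˢ (range (Nat.log 2 y + 1))).image (fun q : ℕ × ℕ => q.1 ^ q.2) := by
      intro k hk
      rw [hS, Finset.mem_filter, Finset.mem_Ioc] at hk
      obtain ⟨⟨-, hky⟩, hncop, hΛ⟩ := hk
      obtain ⟨p, a, hpN, -, ha2, hpa⟩ := exists_pow_eq_of_not_coprime_primorial hΛ hncop
      rw [Finset.mem_image]
      refine ⟨(p, a), ?_, hpa⟩
      rw [Finset.mem_product, Finset.mem_range, Finset.mem_range, Nat.lt_succ_iff]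
      exact ⟨hpN, ha2.trans (Nat.log_mono_right hky)⟩
    calc #S ≤ _ := Finset.card_le_card hsub
      _ ≤ #((range N) ×ˢ (range (Nat.log 2 y + 1))) := Finset.card_image_le
      _ = N * (Nat.log 2 y + 1) := by rw [Finset.card_product, Finset.card_range, Finset.card_range]
  -- per `d`
  have hd : ∀ d ∈ Dset, |∑ k ∈ Ioc 0 y, vonMangoldt k *
      ((1 - (if Nat.Coprime k P then (1 : ℝ) else 0)) *
        (if d ∣ k + 2 then (liouville (k + 2) : ℝ) else 0))| ≤ (N : ℝ) * (Nat.log 2 y + 1 : ℕ) * Real.log y := by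
    intro d _
    -- restrict to the support `S`
    have hzero : ∀ k ∈ Ioc 0 y, k ∉ S → vonMangoldt k *
        ((1 - (if Nat.Coprime k P then (1 : ℝ) else 0)) *
          (if d ∣ k + 2 then (liouville (k + 2) : ℝ) else 0)) = 0 := by
      intro k hk hkS
      rw [hS, Finset.mem_filter, not_and_or, not_and_or, not_not, not_not] at hkS
      rcases hkS with h | h | h
      · exact absurd hk h
      · rw [if_pos h]; ring
      · rw [h, zero_mul]
    rw [← Finset.sum_subset (Finset.filter_subset _ (Ioc 0 y)) (fun k hk hkS => hzero k hk hkS)]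
    calc |∑ k ∈ S, vonMangoldt k * ((1 - (if Nat.Coprime k P then (1 : ℝ) else 0)) *
            (if d ∣ k + 2 then (liouville (k + 2) : ℝ) else 0))|
        ≤ ∑ k ∈ S, Real.log y := by
          refine (Finset.abs_sum_le_sum_abs _ _).trans (Finset.sum_le_sum fun k hk => ?_)
          rw [hS, Finset.mem_filter, Finset.mem_Ioc] at hk
          rw [abs_mul, abs_of_nonneg vonMangoldt_nonneg]
          have h1 : |(1 - (if Nat.Coprime k P then (1 : ℝ) else 0)) *
              (if d ∣ k + 2 then (liouville (k + 2) : ℝ) else 0)| ≤ 1 := by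
            rw [abs_mul]
            have ha : |(1 - (if Nat.Coprime k P then (1 : ℝ) else 0))| ≤ 1 := by
              split_ifs <;> simp
            have hb : |(if d ∣ k + 2 then (liouville (k + 2) : ℝ) else 0)| ≤ 1 := by
              split_ifs
              · exact Literature.NumberTheory.LFunctions.LiouvilleSum.abs_liouville_le_one _
              · simp
            exact (mul_le_mul ha hb (abs_nonneg _) zero_le_one).trans (by norm_num)
          calc vonMangoldt k * _ ≤ vonMangoldt k * 1 := mul_le_mul_of_nonneg_left h1 vonMangoldt_nonneg
            _ ≤ Real.log y := by
                rw [mul_one]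
                exact vonMangoldt_le_log.trans (Real.log_le_log (by exact_mod_cast hk.1.1)
                  (by exact_mod_cast hk.1.2))
      _ = #S * Real.log y := by rw [Finset.sum_const, nsmul_eq_mul]
      _ ≤ (N : ℝ) * (Nat.log 2 y + 1 : ℕ) * Real.log y := by
          refine mul_le_mul_of_nonneg_right ?_ (Real.log_natCast_nonneg y)
          exact_mod_cast hcardS
  calc _ ≤ ∑ d ∈ Dset, (N : ℝ) * (Nat.log 2 y + 1 : ℕ) * Real.log y := Finset.sum_le_sum hd
    _ = _ := by rw [Finset.sum_const, nsmul_eq_mul]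

/-- **Even moduli.**  For even `d`, `d ∣ k+2` and `Λ(k) ≠ 0` force `k = 2^a`:
`∑_{d ≤ D even} |∑_{k ≤ y} Λ(k) f_d(k)| ≤ D (log₂ y + 1)`. -/
theorem sum_abs_even_moduli_le (D y : ℕ) :
    ∑ d ∈ (Icc 1 D).filter (fun d => Even d), |∑ k ∈ Icc 1 y, vonMangoldt k *
        (if d ∣ k + 2 then (liouville (k + 2) : ℝ) else 0)| ≤ D * ((Nat.log 2 y + 1 : ℕ) : ℝ) := by
  classical
  have hd : ∀ d ∈ (Icc 1 D).filter (fun d => Even d), |∑ k ∈ Icc 1 y, vonMangoldt k *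
      (if d ∣ k + 2 then (liouville (k + 2) : ℝ) else 0)| ≤ ((Nat.log 2 y + 1 : ℕ) : ℝ) := by
    intro d hdD
    rw [Finset.mem_filter] at hdD
    obtain ⟨-, heven⟩ := hdD
    -- support: `k = 2^a`, `a ≤ log₂ y`
    set S := (Icc 1 y).filter (fun k => d ∣ k + 2 ∧ vonMangoldt k ≠ 0) with hS
    have hsub : S ⊆ (range (Nat.log 2 y + 1)).image (fun a => 2 ^ a) := by
      intro k hk
      rw [hS, Finset.mem_filter, Finset.mem_Icc] at hk
      obtain ⟨⟨-, hky⟩, hdk, hΛ⟩ := hk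
      have hpp : IsPrimePow k := vonMangoldt_ne_zero_iff.mp hΛ
      obtain ⟨p, a, hp, ha, rfl⟩ := (isPrimePow_nat_iff _).mp hpp
      have h2 : 2 ∣ p ^ a := by
        have h2k2 : 2 ∣ p ^ a + 2 := (even_iff_two_dvd.mp heven).trans hdk
        omega
      have hp2 : p = 2 := ((Nat.prime_dvd_prime_iff_eq Nat.prime_two hp).mp
        (Nat.prime_two.dvd_of_dvd_pow h2)).symm
      subst hp2
      rw [Finset.mem_image]
      exact ⟨a, Finset.mem_range.mpr (Nat.lt_succ_of_le (Nat.le_log_of_pow_le (by norm_num) hky)), rfl⟩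
    have hcard : #S ≤ Nat.log 2 y + 1 :=
      (Finset.card_le_card hsub).trans (Finset.card_image_le.trans (by rw [Finset.card_range]))
    have hzero : ∀ k ∈ Icc 1 y, k ∉ S → vonMangoldt k *
        (if d ∣ k + 2 then (liouville (k + 2) : ℝ) else 0) = 0 := by
      intro k hk hkS
      rw [hS, Finset.mem_filter, not_and_or, not_and_or, not_not] at hkS
      rcases hkS with h | h | h
      · exact absurd hk h
      · rw [if_neg h, mul_zero]
      · rw [h, zero_mul]
    rw [← Finset.sum_subset (Finset.filter_subset _ (Icc 1 y)) (fun k hk hkS => hzero k hk hkS)]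
    calc |∑ k ∈ S, vonMangoldt k * (if d ∣ k + 2 then (liouville (k + 2) : ℝ) else 0)|
        ≤ ∑ k ∈ S, (1 : ℝ) := by
          refine (Finset.abs_sum_le_sum_abs _ _).trans (Finset.sum_le_sum fun k hk => ?_)
          have hkS := hsub hk
          rw [Finset.mem_image] at hkS
          obtain ⟨a, -, rfl⟩ := hkS
          rw [abs_mul, abs_of_nonneg vonMangoldt_nonneg]
          have hΛ2 : vonMangoldt (2 ^ a) ≤ 1 := by
            rcases Nat.eq_zero_or_pos a with rfl | ha
            · simp
            · rw [vonMangoldt_apply_pow ha.ne', vonMangoldt_apply_prime Nat.prime_two]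
              have := Real.log_two_lt_d9; push_cast; linarith
          have hb : |(if d ∣ 2 ^ a + 2 then (liouville (2 ^ a + 2) : ℝ) else 0)| ≤ 1 := by
            split_ifs
            · exact Literature.NumberTheory.LFunctions.LiouvilleSum.abs_liouville_le_one _
            · simp
          exact (mul_le_mul hΛ2 hb (abs_nonneg _) zero_le_one).trans (by norm_num)
      _ = #S := by simp
      _ ≤ ((Nat.log 2 y + 1 : ℕ) : ℝ) := by exact_mod_cast hcard
  calc _ ≤ ∑ d ∈ (Icc 1 D).filter (fun d => Even d), ((Nat.log 2 y + 1 : ℕ) : ℝ) := Finset.sum_le_sum hd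
    _ = #((Icc 1 D).filter (fun d => Even d)) * ((Nat.log 2 y + 1 : ℕ) : ℝ) := by
        rw [Finset.sum_const, nsmul_eq_mul]
    _ ≤ D * ((Nat.log 2 y + 1 : ℕ) : ℝ) := by
        refine mul_le_mul_of_nonneg_right ?_ (Nat.cast_nonneg _)
        exact_mod_cast (Finset.card_filter_le _ _).trans (by simp)

end Summit.Parity.GeneralizedHardyLittlewood.Theorems
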